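import Summits.CriticalPhenomena.CardyFormulaZ2.Theorems.CardyIKTransportIKLinearTransportStubCutMarkovLocalReroute
import Summits.CriticalPhenomena.CardyFormulaZ2.Theorems.CardyIKTransportIKLinearTransportStubCutMarkovLocalTail
import Summits.CriticalPhenomena.CardyFormulaZ2.Theorems.CardyIKTransportIKLinearTransportStubCutMarkovLocalSweep

/-!
# Stub `stub_CutMarkovLocal` (Loc) — part D: THE `2r`-LOCAL APPROXIMANTS of the depth-`r` sweeps of the
# cut-Markov heat bath, for a version with two-sided environment-locality

Support file (`--supports stmt-CriticalPhenomena-5076`, registered sub-goal `cutMarkov_local_approx_of_readsEnv`).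

THE THEOREM: there are absolute constants `C, c > 0` such that for every column pattern `S`, face column `i` and
every cut-Markov version `k` of the conditional middle-row law (`CutMarkovKernel S i k`) which is TWO-SIDED LOCAL IN
THE ENVIRONMENT (`ReadsEnv i k`, `…StubCutMarkovLocalSweep.lean`), for every cell `v` and radius `r` there is a map
`Gfin : Obs → Rnd → Obs` whose output on `ballInf v r` reads the input on `ballInf v (2r)` only, and which agrees —
on the middle cells/faces of `ballInf v r` — with the depth-`(r+1)` sweeps
`rowSweep (rowDyn i crkU (crkG S i k)) (r+1) (w 1 - r) (pinnedStat i x) u (eraseMid i x)` outside an event of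
`νmix S ⊗ β`-probability `≤ C e^{-cr}`. This is the `local_approx` clause of (A_dyn') (`…Reduction.lean`) under the
extra hypothesis `ReadsEnv i k` — the reshaped (Loc).

THE CONSTRUCTION. `Gfin x u` runs the SAME sweeps in the environment of the WINDOW CONFIGURATION `obsWin v r x`
(the observables restricted to `ballInf v (2r)`): `2r`-local by construction (the sweep reads the fresh bits only at
the middle cells of its rows, `crk_sweep_rd`). THE GOOD EVENT: each of the 14 bands of `⌊r/4⌋` rows around the
ball carries a CERTIFIED cut row of `x` (`IsCutCert`). On it, for every target row `y₀` of the ball there are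
certified cuts `c₂ < c₁ < y₀ < c'₁ < c'₂` inside the window; certificates survive the restriction, the window and
the global strip diagrams agree on the pairs between `c₂` and `c'₂` (`stripDiagram_agree_between_certs`), so the
two environments have the cuts `c₁, c'₁` and agree between them, and the two sweeps produce the same row `y₀`
(`sweep_agree_env`) — surely. THE BOUND: a band without certified cut row costs `C_T e^{-c_T(⌊r/4⌋ - 5)}`
(`isCutCert_tail`, finite energy, every pattern `S`), whence `14 C_T e^{6 c_T} e^{-(c_T/4) r}`.
-/

noncomputable section

namespace Summit.CriticalPhenomena.CardyFormulaZ2.Theorems.IKLinearTransport.PinnedDiagramExchange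

open scoped Classical MeasureTheory ENNReal symmDiff
open Set MeasureTheory
open Literature.Probability.Percolation Literature.Probability.LatticeModels

/-! ## The window configuration and the local sweeps -/

section Construction

variable (S : Set ℤ) (i : ℤ) (k : (Obs × Set (Site 2 × Site 2)) × Obs → Bool × Bool × Bool → ℝ) (v : Site 2) (r : ℕ)

/-- The WINDOW CONFIGURATION: the observables restricted to `ballInf v (2r)`. [folklore] -/
def obsWin (x : Obs) : Obs := ({w | w ∈ x.1 ∧ w ∈ ballInf v (2 * r)}, {f | f ∈ x.2 ∧ f ∈ ballInf v (2 * r)})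

/-- The LOCAL SWEEP for the target row `y₀`: the depth-`(r+1)` sweep in the environment of the window configuration,
started blank. [folklore] -/
def locSweep (y₀ : ℤ) (x : Obs) (u : Rnd) : Obs :=
  rowSweep (rowDyn i crkU (crkG S i k)) (r + 1) (y₀ - r) (pinnedStat i (obsWin v r x)) u (eraseMid i (obsWin v r x))

/-- THE LOCAL APPROXIMANT `Gfin`: the middle cells/faces read from the local sweeps of their own rows, the rest
copied. [folklore] -/
def crkGfin (x : Obs) (u : Rnd) : Obs :=
  ({w | if w 0 = i + 1 then w ∈ (locSweep S i k v r (w 1) x u).1 else w ∈ x.1},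
   {f | if f 0 = i ∨ f 0 = i + 1 then f ∈ (locSweep S i k v r (f 1) x u).2 else f ∈ x.2})

/-- Membership in a sup-ball, in linear form. [folklore] -/
theorem mem_ballInf_iff (w : Site 2) (n : ℕ) :
    w ∈ ballInf v n ↔ -(n : ℤ) ≤ w 0 - v 0 ∧ w 0 - v 0 ≤ n ∧ -(n : ℤ) ≤ w 1 - v 1 ∧ w 1 - v 1 ≤ n := by
  simp only [ballInf, mem_setOf_eq, abs_le]; tauto

/-- The window configuration reads the window only. [folklore] -/
theorem obsWin_congr (x x' : Obs) (h : ∀ w ∈ ballInf v (2 * r), (w ∈ x.1 ↔ w ∈ x'.1) ∧ (w ∈ x.2 ↔ w ∈ x'.2)) :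
    obsWin v r x = obsWin v r x' := by
  refine Prod.ext (Set.ext fun w => ?_) (Set.ext fun f => ?_)
  · simp only [obsWin, mem_setOf_eq]
    constructor
    · rintro ⟨h1, h2⟩; exact ⟨(h w h2).1.1 h1, h2⟩
    · rintro ⟨h1, h2⟩; exact ⟨(h w h2).1.2 h1, h2⟩
  · simp only [obsWin, mem_setOf_eq]
    constructor
    · rintro ⟨h1, h2⟩; exact ⟨(h f h2).2.1 h1, h2⟩
    · rintro ⟨h1, h2⟩; exact ⟨(h f h2).2.2 h1, h2⟩

/-- LOCALITY OF `Gfin`: its output on `ballInf v r` reads the input on `ballInf v (2r)` only (`1 ≤ r`). [folklore] -/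
theorem crkGfin_local (hr : 1 ≤ r) (x x' : Obs) (u u' : Rnd)
    (h : ∀ w ∈ ballInf v (2 * r), (w ∈ x.1 ↔ w ∈ x'.1) ∧ (w ∈ x.2 ↔ w ∈ x'.2) ∧ ∀ kk : ℕ, ((w, kk) ∈ u ↔ (w, kk) ∈ u'))
    (w : Site 2) (hw : w ∈ ballInf v r) :
    (w ∈ (crkGfin S i k v r x u).1 ↔ w ∈ (crkGfin S i k v r x' u').1) ∧
      (w ∈ (crkGfin S i k v r x u).2 ↔ w ∈ (crkGfin S i k v r x' u').2) := by
  have hw2 : w ∈ ballInf v (2 * r) := ballInf_mono v (by omega) hw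
  have hwin : obsWin v r x = obsWin v r x' := obsWin_congr v r x x' fun w' hw' => ⟨(h w' hw').1, (h w' hw').2.1⟩
  -- the local sweep of the row of a middle cell/face of the ball reads bits inside the window only
  have hsw : (w 0 = i ∨ w 0 = i + 1) → locSweep S i k v r (w 1) x u = locSweep S i k v r (w 1) x' u' := by
    intro hw0
    rw [locSweep, locSweep, hwin]
    refine crk_sweep_rd S i k (w 1 - r) _ _ u u' (r + 1) fun y hy1 hy2 kk => (h _ ?_).2.2 kk
    rw [mem_ballInf_iff] at hw ⊢
    simp only [Matrix.cons_val_zero, Matrix.cons_val_one, Matrix.cons_val_fin_one]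
    push_cast at hy2 ⊢
    omega
  refine ⟨?_, ?_⟩
  · simp only [crkGfin, mem_setOf_eq]
    by_cases h0 : w 0 = i + 1
    · rw [if_pos h0, if_pos h0, hsw (Or.inr h0)]
    · rw [if_neg h0, if_neg h0]; exact (h w hw2).1
  · simp only [crkGfin, mem_setOf_eq]
    by_cases h0 : w 0 = i ∨ w 0 = i + 1
    · rw [if_pos h0, if_pos h0, hsw h0]
    · rw [if_neg h0, if_neg h0]; exact (h w hw2).2.1

end Construction

/-! ## On the good event the local sweeps reproduce the global ones -/

section Agreement

variable (S : Set ℤ) (i : ℤ) (k : (Obs × Set (Site 2 × Site 2)) × Obs → Bool × Bool × Bool → ℝ) (v : Site 2) (r : ℕ)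

/-- THE GOOD EVENT: each of the 14 bands of `⌊r/4⌋` rows around the ball carries a certified cut row. [folklore] -/
def crkGood (i : ℤ) (v : Site 2) (r : ℕ) : Set Obs :=
  {x | ∀ j : ℤ, -7 ≤ j → j ≤ 6 → ∃ c : ℤ, IsCutCert i c x ∧
    v 1 + ((r / 4 : ℕ) : ℤ) * j + 2 ≤ c ∧ c ≤ v 1 + ((r / 4 : ℕ) : ℤ) * j + (r / 4 : ℕ) - 3}

/-- ON THE GOOD EVENT THE LOCAL SWEEP REPRODUCES THE GLOBAL ONE at every middle cell/face of the ball (`20 ≤ r`),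
for a cut-Markov version with two-sided environment-locality. [folklore] -/
theorem crk_local_agree (hk : CutMarkovKernel S i k) (hke : ReadsEnv i k) (hr : 20 ≤ r) (x : Obs) (u : Rnd)
    (hgood : x ∈ crkGood i v r) (w : Site 2) (hw : w ∈ ballInf v r) (hw0 : w 0 = i ∨ w 0 = i + 1) :
    (w 0 = i + 1 → (w ∈ (rowSweep (rowDyn i crkU (crkG S i k)) (r + 1) (w 1 - r) (pinnedStat i x) u (eraseMid i x)).1 ↔
      w ∈ (locSweep S i k v r (w 1) x u).1)) ∧
    ((w 0 = i ∨ w 0 = i + 1) → (w ∈ (rowSweep (rowDyn i crkU (crkG S i k)) (r + 1) (w 1 - r) (pinnedStat i x) u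
      (eraseMid i x)).2 ↔ w ∈ (locSweep S i k v r (w 1) x u).2)) := by
  set m' : ℕ := r / 4 with hm'
  have hm5 : 5 ≤ m' := by omega
  have hrm : r ≤ 4 * m' + 3 := by omega
  have hm'pos : (0 : ℤ) < m' := by exact_mod_cast (show 0 < m' by omega)
  rw [mem_ballInf_iff] at hw
  set y₀ : ℤ := w 1 with hy₀
  -- the band of the target row
  set j₀ : ℤ := (y₀ - v 1) / m' with hj₀
  set rem : ℤ := (y₀ - v 1) % m' with hrem
  have hdec : rem + m' * j₀ = y₀ - v 1 := Int.emod_add_mul_ediv _ _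
  have hrem0 : 0 ≤ rem := Int.emod_nonneg _ hm'pos.ne'
  have hrem1 : rem < m' := Int.emod_lt_of_pos _ hm'pos
  have hj1 : -5 ≤ j₀ := by
    by_contra hcon
    have : (m' : ℤ) * j₀ ≤ m' * (-6) := Int.mul_le_mul_of_nonneg_left (by omega) hm'pos.le
    omega
  have hj2 : j₀ ≤ 4 := by
    by_contra hcon
    have : (m' : ℤ) * 5 ≤ m' * j₀ := Int.mul_le_mul_of_nonneg_left (by omega) hm'pos.le
    omega
  -- the four certified cuts
  obtain ⟨c₁, hc₁, a1, b1⟩ := hgood (j₀ - 1) (by omega) (by omega)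
  obtain ⟨c₂, hc₂, a2, b2⟩ := hgood (j₀ - 2) (by omega) (by omega)
  obtain ⟨c'₁, hc'₁, a3, b3⟩ := hgood (j₀ + 1) (by omega) (by omega)
  obtain ⟨c'₂, hc'₂, a4, b4⟩ := hgood (j₀ + 2) (by omega) (by omega)
  have e1 : (m' : ℤ) * (j₀ - 1) = m' * j₀ - m' := by ring
  have e2 : (m' : ℤ) * (j₀ - 2) = m' * j₀ - 2 * m' := by ring
  have e3 : (m' : ℤ) * (j₀ + 1) = m' * j₀ + m' := by ring
  have e4 : (m' : ℤ) * (j₀ + 2) = m' * j₀ + 2 * m' := by ring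
  rw [e1] at a1 b1; rw [e2] at a2 b2; rw [e3] at a3 b3; rw [e4] at a4 b4
  -- the window configuration agrees with `x` on the strip rows `[c₂ - 2, c'₂ + 2]`
  set x' := obsWin v r x with hx'
  have hcol : i - 1 ≤ w 0 ∧ w 0 ≤ i + 1 := by omega
  have hagree : ∀ w' : Site 2, i ≤ w' 0 → w' 0 ≤ i + 2 → c₂ - 2 ≤ w' 1 → w' 1 ≤ c'₂ + 2 →
      (w' ∈ x.1 ↔ w' ∈ x'.1) ∧ (w' ∈ x.2 ↔ w' ∈ x'.2) := by
    intro w' h1 h2 h3 h4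
    have hball : w' ∈ ballInf v (2 * r) := by
      rw [mem_ballInf_iff]; push_cast; omega
    simp only [hx', obsWin, mem_setOf_eq]
    exact ⟨⟨fun h' => ⟨h', hball⟩, fun h' => h'.1⟩, ⟨fun h' => ⟨h', hball⟩, fun h' => h'.1⟩⟩
  -- the diagrams agree between the outer cuts; the inner certificates transfer
  have hΔ := stripDiagram_agree_between_certs i c₂ c'₂ x x' hagree hc₂ hc'₂ (by omega)
  have hc₁' : IsCutCert i c₁ x' :=
    (isCutCert_congr i c₁ x x' fun v' h1 h2 h3 h4 => (hagree v' h1 h2 (by omega) (by omega)).1).1 hc₁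
  have hc'₁' : IsCutCert i c'₁ x' :=
    (isCutCert_congr i c'₁ x x' fun v' h1 h2 h3 h4 => (hagree v' h1 h2 (by omega) (by omega)).1).1 hc'₁
  have henv : EnvAgree i (c₁ - 2) (c'₁ + 2) (pinnedStat i x) (pinnedStat i x') := by
    refine ⟨fun w' h1 h2 h3 h4 => ?_, fun q h1 h2 h3 h4 => hΔ q (by omega) (by omega) (by omega) (by omega)⟩
    have hag := hagree w' h1 h2 (by omega) (by omega)
    simp only [pinnedStat, eraseMid, mem_setOf_eq]
    exact ⟨and_congr_left' hag.1, and_congr_left' hag.2⟩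
  -- the two sweeps agree above `c₁` up to the target row
  have key := sweep_agree_env S i k hk hke c₁ c'₁ (y₀ - r) (by omega) (pinnedStat i x) (pinnedStat i x')
    (isCut_pinnedStat_of_cert i c₁ x hc₁) (isCut_pinnedStat_of_cert i c'₁ x hc'₁)
    (isCut_pinnedStat_of_cert i c₁ x' hc₁') (isCut_pinnedStat_of_cert i c'₁ x' hc'₁') henv u (eraseMid i x)
    (eraseMid i x') (r + 1) (by push_cast; omega)
  exact key w (by omega) (by push_cast; omega)

/-- On the good event `Gfin` reproduces the global sweeps on the middle of the ball: the bad event of the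
`local_approx` clause lies over the complement of the good event (`20 ≤ r`). [folklore] -/
theorem crk_bad_subset (hk : CutMarkovKernel S i k) (hke : ReadsEnv i k) (hr : 20 ≤ r) :
    {xu : Obs × Rnd | ∃ w ∈ ballInf v r,
      (w 0 = i + 1 ∧ ¬ (w ∈ (rowSweep (rowDyn i crkU (crkG S i k)) (r + 1) (w 1 - r) (pinnedStat i xu.1) xu.2
          (eraseMid i xu.1)).1 ↔ w ∈ (crkGfin S i k v r xu.1 xu.2).1)) ∨
      ((w 0 = i ∨ w 0 = i + 1) ∧ ¬ (w ∈ (rowSweep (rowDyn i crkU (crkG S i k)) (r + 1) (w 1 - r) (pinnedStat i xu.1)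
          xu.2 (eraseMid i xu.1)).2 ↔ w ∈ (crkGfin S i k v r xu.1 xu.2).2))} ⊆ (crkGood i v r)ᶜ ×ˢ (univ : Set Rnd) := by
  rintro ⟨x, u⟩ ⟨w, hw, hbad⟩
  simp only [mem_prod, mem_compl_iff, mem_univ, and_true]
  intro hgood
  rcases hbad with ⟨h0, hne⟩ | ⟨h0, hne⟩
  · have := (crk_local_agree S i k v r hk hke hr x u hgood w hw (Or.inr h0)).1 h0
    refine hne (this.trans ?_)
    simp only [crkGfin, mem_setOf_eq, if_pos h0]
  · have := (crk_local_agree S i k v r hk hke hr x u hgood w hw h0).2 h0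
    refine hne (this.trans ?_)
    simp only [crkGfin, mem_setOf_eq, if_pos h0]

/-- The complement of the good event: some band has no certified cut row. [folklore] -/
theorem crkGood_compl_subset (hr : 20 ≤ r) :
    (crkGood i v r)ᶜ ⊆ ⋃ j ∈ Finset.Icc (-7 : ℤ) 6,
      {x : Obs | ∀ c' : ℤ, (v 1 + ((r / 4 : ℕ) : ℤ) * j + (r / 4 : ℕ) - 2) - ((r / 4 - 5 : ℕ) : ℤ) - 1 ≤ c' →
        c' ≤ (v 1 + ((r / 4 : ℕ) : ℤ) * j + (r / 4 : ℕ) - 2) - 1 → ¬ IsCutCert i c' x} := by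
  intro x hx
  simp only [crkGood, mem_compl_iff, mem_setOf_eq, not_forall, not_exists, not_and] at hx
  obtain ⟨j, hj1, hj2, hj⟩ := hx
  simp only [mem_iUnion, Finset.mem_Icc, mem_setOf_eq, exists_prop]
  refine ⟨j, ⟨hj1, hj2⟩, fun c' h1 h2 hcert => ?_⟩
  have h5 : ((r / 4 - 5 : ℕ) : ℤ) = ((r / 4 : ℕ) : ℤ) - 5 := by
    have : 5 ≤ r / 4 := by omega
    omega
  exact hj c' hcert (by omega) (by omega)

end Agreement

/-! ## The probability bound and the registered theorem -/

/-- Arithmetic of the constants: `14 · C_T e^{-c_T (⌊r/4⌋ - 5)} ≤ 14 C_T e^{6 c_T} e^{-(c_T/4) r}`. [folklore] -/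
theorem crk_local_arith {CT cT : ℝ} (hcT : 0 < cT) (hCT : 0 ≤ CT) (r : ℕ) (hr : 20 ≤ r) :
    14 * (CT * Real.exp (-cT * ((r / 4 - 5 : ℕ) : ℝ))) ≤
      (14 * CT * Real.exp (6 * cT) + Real.exp (5 * cT)) * Real.exp (-(cT / 4) * r) := by
  have hm : ((r / 4 - 5 : ℕ) : ℝ) = ((r / 4 : ℕ) : ℝ) - 5 := by
    have : 5 ≤ r / 4 := by omega
    rw [Nat.cast_sub this]; norm_num
  have hrm : (r : ℝ) ≤ 4 * ((r / 4 : ℕ) : ℝ) + 3 := by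
    have : r ≤ 4 * (r / 4) + 3 := by omega
    exact_mod_cast this
  have hkey : -cT * (((r / 4 : ℕ) : ℝ) - 5) ≤ 6 * cT + -(cT / 4) * r := by
    have := mul_le_mul_of_nonneg_left hrm (le_of_lt (show 0 < cT / 4 by positivity))
    nlinarith
  have hexp : Real.exp (-cT * ((r / 4 - 5 : ℕ) : ℝ)) ≤ Real.exp (6 * cT) * Real.exp (-(cT / 4) * r) := by
    rw [hm, ← Real.exp_add]; exact Real.exp_le_exp.2 hkey
  have h5 : 0 ≤ Real.exp (5 * cT) * Real.exp (-(cT / 4) * r) := by positivity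
  calc 14 * (CT * Real.exp (-cT * ((r / 4 - 5 : ℕ) : ℝ)))
      ≤ 14 * (CT * (Real.exp (6 * cT) * Real.exp (-(cT / 4) * r))) := by gcongr
    _ ≤ 14 * (CT * (Real.exp (6 * cT) * Real.exp (-(cT / 4) * r))) + Real.exp (5 * cT) * Real.exp (-(cT / 4) * r) :=
        le_add_of_nonneg_right h5
    _ = (14 * CT * Real.exp (6 * cT) + Real.exp (5 * cT)) * Real.exp (-(cT / 4) * r) := by ring

/-- The small radii: `1 ≤ C e^{-c r}` for `r < 20`. [folklore] -/
theorem crk_local_arith_small {CT cT : ℝ} (hcT : 0 < cT) (hCT : 0 ≤ CT) (r : ℕ) (hr : r < 20) :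
    (1 : ℝ) ≤ (14 * CT * Real.exp (6 * cT) + Real.exp (5 * cT)) * Real.exp (-(cT / 4) * r) := by
  have hr' : (r : ℝ) ≤ 19 := by exact_mod_cast Nat.lt_succ_iff.1 hr
  have h1 : (1 : ℝ) ≤ Real.exp (5 * cT) * Real.exp (-(cT / 4) * r) := by
    rw [← Real.exp_add]
    exact Real.one_le_exp (by nlinarith)
  have h2 : 0 ≤ 14 * CT * Real.exp (6 * cT) * Real.exp (-(cT / 4) * r) := by positivity
  nlinarith

/-- THE `2r`-LOCAL APPROXIMANTS OF THE CUT-MARKOV HEAT BATH (registered sub-goal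
`cutMarkov_local_approx_of_readsEnv`): the `local_approx` clause of (A_dyn') for the dynamics
`rowDyn i crkU (crkG S i k)` of every cut-Markov version `k` WITH TWO-SIDED ENVIRONMENT-LOCALITY `ReadsEnv i k`,
with absolute constants, under the input pattern `νmix S ⊗ β` (finite energy; neither the admissibility of `(S, i)`
nor `StripDiagramExchange` is used). [folklore] -/
theorem cutMarkov_local_approx_of_readsEnv : ∃ C c : ℝ, 0 < c ∧ ∀ (S : Set ℤ) (i : ℤ)
    (k : (Obs × Set (Site 2 × Site 2)) × Obs → Bool × Bool × Bool → ℝ),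
    (i ∈ S ↔ i + 1 ∉ S) → StripDiagramExchange S i → CutMarkovKernel S i k → ReadsEnv i k →
    ∀ (v : Site 2) (r : ℕ), ∃ Gfin : Obs → Rnd → Obs,
      (∀ (x x' : Obs) (u u' : Rnd),
        (∀ w ∈ ballInf v (2 * r), (w ∈ x.1 ↔ w ∈ x'.1) ∧ (w ∈ x.2 ↔ w ∈ x'.2) ∧
          ∀ k : ℕ, ((w, k) ∈ u ↔ (w, k) ∈ u')) →
        ∀ w ∈ ballInf v r, (w ∈ (Gfin x u).1 ↔ w ∈ (Gfin x' u').1) ∧ (w ∈ (Gfin x u).2 ↔ w ∈ (Gfin x' u').2)) ∧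
      ((νmix S).prod β) {xu | ∃ w ∈ ballInf v r,
        (w 0 = i + 1 ∧ ¬ (w ∈ (rowSweep (rowDyn i crkU (crkG S i k)) (r + 1) (w 1 - r) (pinnedStat i xu.1) xu.2
            (eraseMid i xu.1)).1 ↔ w ∈ (Gfin xu.1 xu.2).1)) ∨
        ((w 0 = i ∨ w 0 = i + 1) ∧ ¬ (w ∈ (rowSweep (rowDyn i crkU (crkG S i k)) (r + 1) (w 1 - r) (pinnedStat i xu.1)
            xu.2 (eraseMid i xu.1)).2 ↔ w ∈ (Gfin xu.1 xu.2).2))} ≤ ENNReal.ofReal (C * Real.exp (-c * r)) := by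
  obtain ⟨CT, cT, hcT, hCT, hT⟩ := isCutCert_tail
  refine ⟨14 * CT * Real.exp (6 * cT) + Real.exp (5 * cT), cT / 4, by positivity, fun S i k _ _ hk hke v r => ?_⟩
  haveI : IsProbabilityMeasure β := crk_isProbabilityMeasure_beta
  haveI := isProbabilityMeasure_nuMix S
  by_cases hr : 20 ≤ r
  · refine ⟨crkGfin S i k v r, fun x x' u u' h w hw => crkGfin_local S i k v r (by omega) x x' u u' h w hw, ?_⟩
    refine (measure_mono (crk_bad_subset S i k v r hk hke hr)).trans ?_
    rw [Measure.prod_prod, measure_univ, mul_one]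
    refine (measure_mono (crkGood_compl_subset i v r hr)).trans ?_
    refine (measure_biUnion_finset_le _ _).trans ?_
    have hterm : ∀ j ∈ Finset.Icc (-7 : ℤ) 6, (νmix S) {x : Obs | ∀ c' : ℤ,
        (v 1 + ((r / 4 : ℕ) : ℤ) * j + (r / 4 : ℕ) - 2) - ((r / 4 - 5 : ℕ) : ℤ) - 1 ≤ c' →
        c' ≤ (v 1 + ((r / 4 : ℕ) : ℤ) * j + (r / 4 : ℕ) - 2) - 1 → ¬ IsCutCert i c' x} ≤
        ENNReal.ofReal (CT * Real.exp (-cT * ((r / 4 - 5 : ℕ) : ℝ))) := fun j _ => hT S i _ _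
    refine (Finset.sum_le_sum hterm).trans ?_
    rw [Finset.sum_const, Int.card_Icc, show ((6 : ℤ) + 1 - -7).toNat = 14 from rfl, nsmul_eq_mul]
    rw [show ((14 : ℕ) : ℝ≥0∞) = ENNReal.ofReal 14 by simp, ← ENNReal.ofReal_mul (by norm_num)]
    exact ENNReal.ofReal_le_ofReal (crk_local_arith hcT hCT r hr)
  · refine ⟨fun x _ => x, fun x x' u u' h w hw => ⟨(h w (ballInf_mono v (by omega) hw)).1,
      (h w (ballInf_mono v (by omega) hw)).2.1⟩, ?_⟩
    refine prob_le_one.trans ?_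
    rw [← ENNReal.ofReal_one]
    exact ENNReal.ofReal_le_ofReal (crk_local_arith_small hcT hCT r (not_le.1 hr))

end Summit.CriticalPhenomena.CardyFormulaZ2.Theorems.IKLinearTransport.PinnedDiagramExchange
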